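import Literature.Geometry.Lorentzian.KerrIngoingCoordKretschmann
import Literature.Geometry.Lorentzian.KerrIngoingCoordCubicInvariant
import Literature.Geometry.Lorentzian.KerrCurvatureInvariantsTransport
import Literature.Geometry.Lorentzian.KerrKretschmannScalar
import HarnessLib

/-!
# The curvature invariants of the Kerr metric in the Kerr–Schild chart: discharge of the named fact
# `Kerr.kretschmannScalar_closedForm`, and the cubic Weyl invariant

**Theorems** (all proved; no definitions; no named facts taken).

* `Kerr.kretschmannScalar_closedForm_holds : Kerr.kretschmannScalar_closedForm` — DISCHARGE of the
  named fact of `KerrKretschmannScalar.lean` (Visser arXiv:0706.0622, §3; Henry, ApJ 535 (2000) 350):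
  for all real `M, a` and every point `x` of the ingoing Kerr–Schild Cartesian chart with
  `r = Kerr.radius a x > 0`, `|Rm|²(Kerr.bilin M a)(x) = 48 M² Re (r + i a cos θ)⁶ / (r² + a²cos²θ)⁶`,
  `cos θ = x₃ / r`. It makes unconditional, in this respect, every consumer of the fact (the final
  theorems of `FlatQuietCollarExclusion.lean`, `Kerr.kretschmannScalar_equatorial(_pos)`, …).
* `Kerr.cubicWeylInvariant_closedForm` — for all `M, a`, all `x` with `r > 0` and EVERY basis `b` of
  `E4`, `Σ g^{ii'}g^{jj'}g^{kk'} tr(R(b_i,b_j)(R(b_{j'},b_k)R(b_{k'},b_{i'}))) = 48 M³ Re (r + i a cos θ)⁹ / (r² + a²cos²θ)⁹`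
  (type D: `48 Re J = −48 Re Ψ₂³`, `Ψ₂ = −M/(r − ia cos θ)³`; Kinnersley 1969; Chandrasekhar 1983,
  §58) — the Literature-level form of the statement used Summit-side as `stub_factKerrCubicWeyl`.

## Proof

The closed forms in ingoing Kerr coordinates — `Kerr.Ingoing.rmNormSqAt_bilin`
(`KerrIngoingCoordKretschmann.lean`, coordinate contraction) and `Kerr.Ingoing.cubicTrace_basisFun`
(`KerrIngoingCoordCubicInvariant.lean`, rational principal frame) — are carried to the Cartesian chart,
axis included, by the transport theorems `Kerr.rmNormSqAt_kerrBilin_of_ingoing` and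
`Kerr.cubicTrace_kerrBilin_of_ingoing` (`KerrCurvatureInvariantsTransport.lean`); the only algebra
left is `Σ = r² + a²μ² = r² + (aμ)²`.

## References

* M. Visser, *The Kerr spacetime: a brief introduction*, arXiv:0706.0622, §3, §5. [arXiv07060622]
* R. C. Henry, *Kretschmann scalar for a Kerr–Newman black hole*, Astrophys. J. 535 (2000) 350.
* W. Kinnersley, *Type D vacuum metrics*, J. Math. Phys. 10 (1969) 1195; S. Chandrasekhar, *The
  mathematical theory of black holes* (1983), §58.
* R. P. Kerr, A. Schild (1965), §3. [KerrSchild1965]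
-/

noncomputable section

open Literature.Geometry.Lorentzian.MetricCoord

namespace Literature.Geometry.Lorentzian

namespace Kerr

/-- **The Kretschmann scalar of the Kerr metric in closed form — the named fact
`Kerr.kretschmannScalar_closedForm` HOLDS**: `|Rm|² = 48 M² Re (r + i a cos θ)⁶ / Σ⁶` at every point
of the Kerr–Schild Cartesian chart with `r > 0` (Visser arXiv:0706.0622, §3). [cite: arXiv07060622, §3] -/
theorem kretschmannScalar_closedForm_holds : kretschmannScalar_closedForm := fun M a x hx ↦
  rmNormSqAt_kerrBilin_of_ingoing M a
    (fun u hu ↦ by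
      rw [Ingoing.rmNormSqAt_bilin M a (Ingoing.mem_regularSet_of_mem_coordDomain hu),
        show u 1 ^ 2 + (a * u 2) ^ 2 = Ingoing.sigma a u from by simp only [Ingoing.sigma, mul_pow]]
      ring)
    x hx

/-- **The cubic Weyl invariant of the Kerr metric in closed form**: in every basis `b` of `E4` and at
every point of the Kerr–Schild Cartesian chart with `r > 0`,
`Σ g^{ii'}g^{jj'}g^{kk'} tr(R(b_i,b_j)(R(b_{j'},b_k)R(b_{k'},b_{i'}))) = 48 M³ Re (r + i a cos θ)⁹ / Σ⁹`,
`cos θ = x₃ / r` (type D, `48 Re J`, `J = −Ψ₂³`, `Ψ₂ = −M/(r − ia cos θ)³`). [cite: arXiv07060622, §3] -/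
theorem cubicWeylInvariant_closedForm (M a : ℝ) (x : E4) (hx : 0 < radius a x)
    (b : Module.Basis (Fin 4) ℝ E4) :
    ∑ i, ∑ i', ∑ j, ∑ j', ∑ k, ∑ k',
        ginv (Kerr.bilin M a) b x i i' * ginv (Kerr.bilin M a) b x j j' * ginv (Kerr.bilin M a) b x k k' *
        traceCLM E4 ((riemAt (Kerr.bilin M a) x (b i) (b j)).comp
          ((riemAt (Kerr.bilin M a) x (b j') (b k)).comp (riemAt (Kerr.bilin M a) x (b k') (b i')))) =
      48 * M ^ 3 * (((radius a x : ℂ) + ((a * (x 3 / radius a x) : ℝ) : ℂ) * Complex.I) ^ 9).re /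
        (radius a x ^ 2 + (a * (x 3 / radius a x)) ^ 2) ^ 9 :=
  cubicTrace_kerrBilin_of_ingoing M a
    (fun _ hu ↦ Ingoing.cubicTrace_basisFun M a (Ingoing.mem_regularSet_of_mem_coordDomain hu))
    x hx b

end Kerr

end Literature.Geometry.Lorentzian

end
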